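import Summits.KontsevichZagierPeriods.KontsevichZagierPeriods.Theses.HurwitzMicroSectors
import Summits.KontsevichZagierPeriods.KontsevichZagierPeriods.Theorems.HurwitzMicroSectorsNormalFormPrinciplePiBoxTransfer
import Summits.KontsevichZagierPeriods.KontsevichZagierPeriods.Theorems.HurwitzMicroSectorsNormalFormPrincipleVariants2283
import Summits.KontsevichZagierPeriods.KontsevichZagierPeriods.Theorems.HurwitzMicroSectorsNormalFormPrincipleVariants2284

/-! TTRL-lite variant V2285 of stmt-KontsevichZagierPeriods-3869

Variant V2285 = `stub_boxRigidity` (the leaf `BoxRigidity` of `NormalFormPrinciple`: two BOX-RATIONAL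
representations — domain the open unit box, integrand `p/q` over `ℚ` — with equal values are
KZ-equivalent) under the two-sided move `bound_nat:m≤5; bound_nat:m'≤2`. Verdict of the attempt seat:
**open** — this file is the exact-strength certificate, not a proof of the variant. With
`BoxVanishing K` := "every box-rational representation of dimension `K` and value `0` is a relation":
* `V2285 ⟹ BoxVanishing 5` (`boxVanishing_five_of_stub_boxRigidity_var2285`: take `m = 5`, `m' = 0` and
  compare with the zero representation on the `0`-box, which is box-rational of value `0` and itself a
  relation);
* `BoxVanishing 5 ⟹ BoxRigidity for all m, m' ≤ 5` (`boxRigidityLe_five_of_boxVanishing_five`, sibling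
  file `…Variants2284`, imported: pad both representations to the `5`-box by unit intervals, `pad_le`,
  subtract on the common box, `sub_same` — tree, file `…StubBoxCombine`; the difference has value `0` by
  soundness);
* hence `V2285 ⟺ BoxVanishing 5 ⟺ BoxRigidity(m, m' ≤ 5)` (`stub_boxRigidity_var2285_iff_boxVanishing_five`,
  `stub_boxRigidity_var2285_iff_le_five`): the bound `m' ≤ 2` is idle, and V2285 has EXACTLY the strength of
  its siblings V2284 (`fix m = 5; m' ≤ 2`, `stub_boxRigidity_var2285_iff_var2284`) and V2283 (`m = 5, m' = 2`,
  `stub_boxRigidity_var2285_iff_var2283`), all three being `BoxVanishing 5`;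
* `KontsevichZagierPeriods ⟹ parent leaf ⟹ V2285` (`stub_boxRigidity_var2285_of_statement`,
  `stub_boxRigidity_var2285_of_parent`), so a refutation of V2285 would refute the Summit, and the tree has
  no invariant of `KZ.relations` finer than `eval` (soundness) with which to attempt one.
Why open: `BoxVanishing 5 ⟹ BoxVanishing 2` (`boxVanishing_le_five_of_stub_boxRigidity_var2285`, via the
sibling's `boxVanishing_le_five_of_boxVanishing_five`), which
asserts that every vanishing `∫∫_{(0,1)²} p/q` (`p, q ∈ ℚ[x,y]`, `q ≠ 0` on the open square, absolutely
convergent) is generated by the four moves; for the family `[(0,1)², (1 − c(1+x²y²))/(1+x²y²)]`, value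
`G − c` (`G` = Catalan's constant, `c : ℚ`), the side conditions of every move are sentences of the theory
of real closed fields in the parameter `c`, so a chain valid at `c` forces `G = c` by soundness: a proof
must, uniformly in `c`, refute `G = c` (irrationality of `G`, open) or make `G` satisfy a definite
algebraic equation. The tree's knowledge stops at `m, m' ≤ 1` (`boxRigidity_of_le_one`, Baker, file
`…BoxRigidityDimOne`). Residual goal: `BoxVanishing 5`.
Source: M. Kontsevich, D. Zagier, *Periods* (2001), §1.2 Conjecture 1 and rules 1)–3).
Pure proof file, no definitions. -/

-- `Summit.<Summit>.<Problem>` is the tree's mandated summit-side namespace (CONVENTIONS §2); for this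
-- single-conjunct summit the two coincide, so the duplicate is deliberate.
set_option linter.dupNamespace false

noncomputable section

namespace Summit.KontsevichZagierPeriods.KontsevichZagierPeriods.Theorems

open MeasureTheory Set
open Literature.NumberTheory.Transcendental Literature.NumberTheory.Transcendental.KZ
open Summit.KontsevichZagierPeriods.KontsevichZagierPeriods.Theses.HurwitzMicroSectors
open Summit.KontsevichZagierPeriods.HurwitzMicroSectors.NormalFormPrinciple.PiBox

/-! ## V2285 ⇒ `BoxVanishing 5` -/

/-- **V2285 ⇒ `BoxVanishing 5`**: compare a box-rational `N : IntegralRep 5` of value `0` with the zero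
representation on the `0`-box (`m = 5 ≤ 5`, `m' = 0 ≤ 2`; box-rational, value `0`, itself a relation).
[cite: KontsevichZagier2001, §1.2 Conjecture 1] -/
theorem boxVanishing_five_of_stub_boxRigidity_var2285
    (h : ∀ (m m' : ℕ) (N : IntegralRep m) (N' : IntegralRep m'), m' ≤ 2 → m ≤ 5 → N.domain = {x | ∀ i, x i ∈ Set.Ioo (0:ℝ) 1} → N.IsRational → N'.domain = {x | ∀ i, x i ∈ Set.Ioo (0:ℝ) 1} → N'.IsRational → N.value = N'.value → Equivalent N N')
    (N : IntegralRep 5) (hNd : N.domain = {x | ∀ i, x i ∈ Set.Ioo (0:ℝ) 1}) (hNr : N.IsRational)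
    (hv : N.value = 0) : of N ∈ relations := by
  obtain ⟨Z, hZd, hZi⟩ := exists_zeroRep (isSemialgebraic_box 0)
  have hZ : of Z ∈ relations := of_mem_relations_of_eqOn_zero Z (by simp [hZi, EqOn])
  have hZv : Z.value = 0 := by simp [IntegralRep.value, hZi]
  have hZr : Z.IsRational := ⟨0, 1, fun x _ => by simp, fun x _ => by simp [hZi]⟩
  have h' : of N - of Z ∈ relations :=
    h 5 0 N Z (Nat.zero_le 2) le_rfl hNd hNr hZd hZr (by rw [hv, hZv])
  have := relations.add_mem h' hZ
  rwa [sub_add_cancel] at this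

/-! ## The variant V2285 itself: exactly `BoxVanishing 5` -/

/-- **V2285 ⟺ `BoxVanishing 5`** — the exact strength of the variant: Conjecture 1 of
Kontsevich–Zagier for box-rational periods of dimension `≤ 5`. [cite: KontsevichZagier2001, §1.2 Conjecture 1] -/
theorem stub_boxRigidity_var2285_iff_boxVanishing_five :
    (∀ (m m' : ℕ) (N : IntegralRep m) (N' : IntegralRep m'), m' ≤ 2 → m ≤ 5 → N.domain = {x | ∀ i, x i ∈ Set.Ioo (0:ℝ) 1} → N.IsRational → N'.domain = {x | ∀ i, x i ∈ Set.Ioo (0:ℝ) 1} → N'.IsRational → N.value = N'.value → Equivalent N N') ↔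
    (∀ (M : IntegralRep 5), M.domain = {x | ∀ i, x i ∈ Set.Ioo (0:ℝ) 1} → M.IsRational →
      M.value = 0 → of M ∈ relations) :=
  ⟨boxVanishing_five_of_stub_boxRigidity_var2285,
    fun hvan m m' N N' hm' hm =>
      boxRigidityLe_five_of_boxVanishing_five hvan m m' N N' hm (hm'.trans (by norm_num))⟩

/-- **V2285 ⟺ `BoxRigidity` for all `m, m' ≤ 5`**: the bound `m' ≤ 2` is idle — V2285 coincides with
the two-sided variant `bound_nat:m≤5; bound_nat:m'≤5` and with every sibling of maximum dimension `5`.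
[cite: KontsevichZagier2001, §1.2 Conjecture 1] -/
theorem stub_boxRigidity_var2285_iff_le_five :
    (∀ (m m' : ℕ) (N : IntegralRep m) (N' : IntegralRep m'), m' ≤ 2 → m ≤ 5 → N.domain = {x | ∀ i, x i ∈ Set.Ioo (0:ℝ) 1} → N.IsRational → N'.domain = {x | ∀ i, x i ∈ Set.Ioo (0:ℝ) 1} → N'.IsRational → N.value = N'.value → Equivalent N N') ↔
    (∀ (m m' : ℕ) (N : IntegralRep m) (N' : IntegralRep m'), m ≤ 5 → m' ≤ 5 →
      N.domain = {x | ∀ i, x i ∈ Set.Ioo (0:ℝ) 1} → N.IsRational →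
      N'.domain = {x | ∀ i, x i ∈ Set.Ioo (0:ℝ) 1} → N'.IsRational →
      N.value = N'.value → Equivalent N N') := by
  rw [stub_boxRigidity_var2285_iff_boxVanishing_five, ← stub_boxRigidity_var2284_iff_boxVanishing_five]
  exact stub_boxRigidity_var2284_iff_le_five

/-- **V2285 ⟺ V2284** (the sibling `fix_nat:m=5; bound_nat:m'≤2`): relaxing the frozen `m = 5` to
`m ≤ 5` changes nothing, both being `BoxVanishing 5`. [cite: KontsevichZagier2001, §1.2 Conjecture 1] -/
theorem stub_boxRigidity_var2285_iff_var2284 :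
    (∀ (m m' : ℕ) (N : IntegralRep m) (N' : IntegralRep m'), m' ≤ 2 → m ≤ 5 → N.domain = {x | ∀ i, x i ∈ Set.Ioo (0:ℝ) 1} → N.IsRational → N'.domain = {x | ∀ i, x i ∈ Set.Ioo (0:ℝ) 1} → N'.IsRational → N.value = N'.value → Equivalent N N') ↔
    (∀ (m' : ℕ) (N : IntegralRep 5) (N' : IntegralRep m'), m' ≤ 2 → N.domain = {x | ∀ i, x i ∈ Set.Ioo (0:ℝ) 1} → N.IsRational → N'.domain = {x | ∀ i, x i ∈ Set.Ioo (0:ℝ) 1} → N'.IsRational → N.value = N'.value → Equivalent N N') := by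
  rw [stub_boxRigidity_var2285_iff_boxVanishing_five, stub_boxRigidity_var2284_iff_boxVanishing_five]

/-- **V2285 ⟺ V2283** (the sibling `fix_nat:m=5; fix_nat:m'=2`): a fully frozen pair `(5, 2)` already
controls `BoxVanishing 5` (compare with the zero representation on the SQUARE), so the three variants
V2283, V2284, V2285 are one and the same statement. [cite: KontsevichZagier2001, §1.2 Conjecture 1] -/
theorem stub_boxRigidity_var2285_iff_var2283 :
    (∀ (m m' : ℕ) (N : IntegralRep m) (N' : IntegralRep m'), m' ≤ 2 → m ≤ 5 → N.domain = {x | ∀ i, x i ∈ Set.Ioo (0:ℝ) 1} → N.IsRational → N'.domain = {x | ∀ i, x i ∈ Set.Ioo (0:ℝ) 1} → N'.IsRational → N.value = N'.value → Equivalent N N') ↔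
    (∀ (N : IntegralRep 5) (N' : IntegralRep 2), N.domain = {x | ∀ i, x i ∈ Set.Ioo (0:ℝ) 1} → N.IsRational → N'.domain = {x | ∀ i, x i ∈ Set.Ioo (0:ℝ) 1} → N'.IsRational → N.value = N'.value → Equivalent N N') := by
  rw [stub_boxRigidity_var2285_iff_boxVanishing_five, stub_boxRigidity_var2283_iff_boxVanishing_five]

/-- **V2285 ⇒ `BoxVanishing` in every dimension `≤ 5`**, in particular the dimension-`2` statement that
every vanishing `ℚ`-combination of absolutely convergent `∫∫_{(0,1)²} p/q` is generated by the moves —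
the first open dimension (the residual goal of this attempt). [cite: KontsevichZagier2001, §1.2 Conjecture 1] -/
theorem boxVanishing_le_five_of_stub_boxRigidity_var2285
    (h : ∀ (m m' : ℕ) (N : IntegralRep m) (N' : IntegralRep m'), m' ≤ 2 → m ≤ 5 → N.domain = {x | ∀ i, x i ∈ Set.Ioo (0:ℝ) 1} → N.IsRational → N'.domain = {x | ∀ i, x i ∈ Set.Ioo (0:ℝ) 1} → N'.IsRational → N.value = N'.value → Equivalent N N')
    {j : ℕ} (hj : j ≤ 5) (N : IntegralRep j) (hNd : N.domain = {x | ∀ i, x i ∈ Set.Ioo (0:ℝ) 1})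
    (hNr : N.IsRational) (hv : N.value = 0) : of N ∈ relations :=
  boxVanishing_le_five_of_boxVanishing_five (boxVanishing_five_of_stub_boxRigidity_var2285 h) hj N
    hNd hNr hv

/-- **The parent leaf ⇒ V2285** (specialisation; both bounds are dropped).
[cite: KontsevichZagier2001, §1.2 Conjecture 1] -/
theorem stub_boxRigidity_var2285_of_parent
    (h : ∀ (m m' : ℕ) (N : IntegralRep m) (N' : IntegralRep m'), N.domain = {x | ∀ i, x i ∈ Set.Ioo (0:ℝ) 1} → N.IsRational → N'.domain = {x | ∀ i, x i ∈ Set.Ioo (0:ℝ) 1} → N'.IsRational → N.value = N'.value → Equivalent N N') :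
    ∀ (m m' : ℕ) (N : IntegralRep m) (N' : IntegralRep m'), m' ≤ 2 → m ≤ 5 → N.domain = {x | ∀ i, x i ∈ Set.Ioo (0:ℝ) 1} → N.IsRational → N'.domain = {x | ∀ i, x i ∈ Set.Ioo (0:ℝ) 1} → N'.IsRational → N.value = N'.value → Equivalent N N' :=
  fun m m' N N' _ _ => h m m' N N'

/-- **`KontsevichZagierPeriods ⇒ V2285`**: the variant is a special case of Conjecture 1 for the tree's
calculus (`leaves_of_statement`) — so a refutation of the variant would refute the Summit.
[cite: KontsevichZagier2001, §1.2 Conjecture 1] -/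
theorem stub_boxRigidity_var2285_of_statement (h : _root_.KontsevichZagierPeriods) :
    ∀ (m m' : ℕ) (N : IntegralRep m) (N' : IntegralRep m'), m' ≤ 2 → m ≤ 5 → N.domain = {x | ∀ i, x i ∈ Set.Ioo (0:ℝ) 1} → N.IsRational → N'.domain = {x | ∀ i, x i ∈ Set.Ioo (0:ℝ) 1} → N'.IsRational → N.value = N'.value → Equivalent N N' :=
  stub_boxRigidity_var2285_of_parent (leaves_of_statement h).1

end Summit.KontsevichZagierPeriods.KontsevichZagierPeriods.Theorems

end
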